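import Summits.QuantumFields.BalabanUV.T4Continuum.Support.B13StepTermTranslate

/-!
# NE5 ∕ U3, crux O1, row O1-d1 follower (iii-c) — `B13StepTermCoding`: THE ANCHORED CODING OF RECORD of the (2.13)-term labels
# (design `B13StepDesign.md` v0.3 RULING R9 «anchored term labels» as a kernel object): coding a label relative to an anchor cube of
# `X` lands in the catalogue of the recentred domain, which is PINNED AT THE ORIGIN — so the codes in use at an output level are
# origin-pinned labels, not volume-many (part 3 of 3)

Cell `pub-balaban`, unit `b2b-balaban-t4-ne5-formalise-leaf-02` (NE5 formalisation swarm, leaf prover 02 — holder lineage of row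
O1-d1 of `t4/b2b-balaban-t4-ne5-p1/O1-CLAIM-TABLE-NE5-P1.md` v1.3; journal INTENT l.8957; design `B13StepDesign.md` v0.3 RULING R9
«anchored term labels»).  Summits-side NEW WORK under the LEAN PLACEMENT RULE (cell modelling + kernel-checked bookkeeping on the swarm's
objects of record; nothing of the manuscripts under audit is asserted — [II] = [Balaban1988RG2Cluster] and [Balaban1987RG1] are cited
for KIND∕locus only).
HONEST FRAMING: rung (B)+1 bookkeeping for the FINITE-VOLUME T⁴ programme — NOT the continuum limit by itself, NOT infinite
volume, NOT a mass gap, NOT Clay; NE5 NOT PROVED; spine 0∕9.  HONEST DEPENDENCY (cell line, verbatim): continuum YM on T⁴ ⇐ BetaPertH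
∧ nine spine estimates (0/9 proved); BetaPertH ⇐ (D1) ∧ (D4) ∧ CAP+tail; G-an2-4 gates asym, D1 and NE2/3/4.

WHY.  The owner's design v0.3 rules (R9): *term labels of record are SHAPES RELATIVE TO `X` (translation-covariant coding through O1-a's
torus translations); d2∕d3 may work with absolute labels and re-code losslessly at the end (`B13StepTermLabels.Coding` ∕
`Coding.termRep_lift`)*.  Before this series the tree held the generic tool `Coding` and ONE instance, the extensive `Coding.absolute`;
no translation-covariant coding existed in the kernel.  This file supplies the instance OF RECORD on `B13Carriers.TwoRuns.carriers` for
the geometry of record `B13DomainGeometryTR.domainGeometry R` and the inner data of record `B13InnerData.b13InnerData R`, with the exact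
range in which it is covariant (parts 1–2: `B13StepTermShift`, `B13StepTermTranslate`).

WHAT IS PROVED (kernel-checked; imports part 2 BY NAME and, through it, leaf-05's `Dom.anchor`∕`Dom.recentre`∕`zero_mem_recentre`).
* **`anchored R : Coding (domainGeometry R) (b13InnerData R) (TermIdx R.carriers.Dom (Bnd R))`**, `code k X t := t.translate (scale X)
  (−Dom.anchor X)` — injective on ALL labels; `recentre_eq_translateAt`; `codeTuple`.
* **`localizesAt_code_iff`** (scale of `X` in range): a code localizes at `Dom.recentre X` iff the label localizes at `X`;
  **`termLabels_map_anchored`**: the catalogue of codes at `X` IS the catalogue of the recentred domain; **`code_pinned`**: every code of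
  a localizing label localizes at a domain of the same scale CONTAINING THE ORIGIN CUBE; **`codes_subset_pinned`**: at an output scale
  `k` in range, the codes in use over ALL `X ∈ 𝐃_k` lie in the union of the catalogues of the ORIGIN-PINNED domains `S ∈ 𝐃_k` — the
  kernel form of R9's consequence *«G = ONE (1.26)-type shape sum, volume-uniform»* (a termwise weight read on codes is summed over
  origin-pinned labels, which is what a (1.26)-type sum counts, not over the volume).
* **`sum_code_eq`** ∕ **`sum_code_le_pinned`** — R9's VOLUME-UNIFORM BUDGET in kernel form: a nonnegative `X`-blind weight read on
  the codes at ANY `X ∈ 𝐃_k` sums to at most ONE origin-pinned shape sum `Σ_{S ∈ 𝐃_k, 0 ∈ S} Σ_{q ∈ termLabels k S n} f q`.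
* `termRep_anchored` = `B13StepTermLabels.Coding.termRep_lift` at the instance (any `TermRep` over absolute labels re-codes losslessly,
  BY NAME); `coeff_code` (the code keeps `ρᵀ∕(n+1)!` and the tree lengths, so termwise weights built from them are `X`-blind on codes).
REMARK (recorded, not used): `Dom.anchor` is a CHOICE of a cube and is not translation-equivariant — it cannot be in general, a domain
wrapping around the torus has a non-trivial stabiliser — so `recentre X` is a shape REPRESENTATIVE pinned at the origin, not an orbit
invariant; origin-pinning is all that volume-uniformity needs.  HONEST SIDE CONDITION: the catalogue identities carry `scale X + m′ ≤
m + K`.  NOT an estimate; no END face or consumer re-wired (the END faces of record run on per-`X` budgets); 0∕12 skeleton leaves on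
Bałaban's concrete objects unchanged; NE5 NOT PROVED.  0 sorry; axioms ⊆ {propext, Classical.choice, Quot.sound}.
-/

noncomputable section

namespace Summit.QuantumFields.BalabanUV.T4Continuum.B13StepTermCoding

open scoped BigOperators
open Literature.MathematicalPhysics.QuantumFieldTheory.Balaban1983to89
open Literature.MathematicalPhysics.QuantumFieldTheory.Balaban1983to89.TreeLengthTorus (TPt TDom)
open Literature.MathematicalPhysics.QuantumFieldTheory.Balaban1983to89.T4InputCauchyRateData (StepModel)
open Literature.MathematicalPhysics.QuantumFieldTheory.Balaban1983to89.T4InputCauchyRateTermwise (TermRep)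
open Summit.QuantumFields.BalabanUV.T4Continuum.B13Carriers (TwoRuns)
open Summit.QuantumFields.BalabanUV.T4Continuum.B13InnerData (Bnd b13InnerData)
open Summit.QuantumFields.BalabanUV.T4Continuum.B13StepTermLabels (InnerLabel PolyLabel TermIdx Coding termLabels mem_termLabels coeff)
open Summit.QuantumFields.BalabanUV.T4Continuum.B13DomainGeometryTR (domainGeometry)
open Summit.QuantumFields.BalabanUV.T4Continuum.B13StepTermShift
open Summit.QuantumFields.BalabanUV.T4Continuum.B13StepTermTranslate

variable {G : Type} [GaugeGroup G] (R : TwoRuns G)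

/-! ## The anchored coding of record; the catalogue of codes is origin-pinned -/

section Anchored

open B13CarriersTranslation (Dom.anchor Dom.recentre Dom.zero_mem_recentre)

/-- [folklore] **THE ANCHORED CODING OF RECORD** (design v0.3 R9): a term label is coded RELATIVE TO `X` by translating it, at
every level it touches, so that the anchor cube of `X` (leaf-05's `Dom.anchor X`) goes to the origin of `π_{scale X}`.  Injective on
all labels (translation by a fixed vector has an inverse), a fortiori on those localizing at `X`. -/
def anchored : Coding (domainGeometry R) (b13InnerData R) (TermIdx R.carriers.Dom (Bnd R)) where
  code _ X t := TermIdx.translate X.1 (-Dom.anchor X) t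
  inj _ X _ _ _ _ h := TermIdx.translate_injective X.1 _ h

variable {R}

/-- [folklore] The code of a label, unfolded (definitional). -/
theorem anchored_code (k : ℕ) (X : R.carriers.Dom) (t : TermIdx R.carriers.Dom (Bnd R)) :
    (anchored R).code k X t = TermIdx.translate X.1 (-Dom.anchor X) t := rfl

/-- [folklore] The recentred domain of leaf-05 is the translate of `X` by minus its anchor in the sense of this file. -/
theorem recentre_eq_translateAt (X : R.carriers.Dom) : Dom.recentre X = translateAt X.1 (-Dom.anchor X) X := by
  obtain ⟨j, Y⟩ := X
  rw [translateAt_self]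
  rfl

/-- [folklore] The tuple part of the code: an embedding of tuples of factor labels. -/
def codeTuple (X : R.carriers.Dom) (n : ℕ) :
    (Fin (n + 1) → PolyLabel R.carriers.Dom (Bnd R)) ↪ (Fin (n + 1) → PolyLabel R.carriers.Dom (Bnd R)) :=
  ⟨translateTuple X.1 (-Dom.anchor X), translateTuple_injective X.1 _⟩

/-- [folklore] The code of `⟨n, p⟩` is `⟨n, codeTuple X n p⟩` (definitional). -/
theorem anchored_code_mk (k : ℕ) (X : R.carriers.Dom) {n : ℕ} (p : Fin (n + 1) → PolyLabel R.carriers.Dom (Bnd R)) :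
    (anchored R).code k X ⟨n, p⟩ = ⟨n, codeTuple X n p⟩ := rfl

/-- [folklore] **A CODE LOCALIZES AT THE RECENTRED DOMAIN iff THE LABEL LOCALIZES AT `X`** (scale of `X` in the meaningful range). -/
theorem localizesAt_code_iff {X : R.carriers.Dom} (hX : X.1 + R.m' ≤ R.F.m + R.K) (k : ℕ)
    (t : TermIdx R.carriers.Dom (Bnd R)) :
    ((anchored R).code k X t).LocalizesAt (domainGeometry R) (b13InnerData R) k (Dom.recentre X) ↔
      t.LocalizesAt (domainGeometry R) (b13InnerData R) k X := by
  by_cases hjk : R.carriers.scale X = k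
  · obtain ⟨j, Y⟩ := X
    change j = k at hjk
    subst hjk
    rw [recentre_eq_translateAt]
    exact localizesAt_translate_iff hX _ _ t
  · constructor
    · intro h
      have hs := scale_eq_of_localizesAt h
      rw [B13CarriersTranslation.Dom.scale_recentre] at hs
      exact absurd hs hjk
    · intro h
      exact absurd (scale_eq_of_localizesAt h) hjk

/-- [folklore] **THE CATALOGUE OF CODES AT `X` IS THE CATALOGUE OF THE RECENTRED DOMAIN** (scale of `X` in range): coding the term
labels with `n + 1` factors localizing at `X` gives exactly the term labels localizing at `Dom.recentre X`. -/
theorem termLabels_map_anchored {X : R.carriers.Dom} (hX : X.1 + R.m' ≤ R.F.m + R.K) (k n : ℕ) :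
    (termLabels (domainGeometry R) (b13InnerData R) k X n).map (codeTuple X n) =
      termLabels (domainGeometry R) (b13InnerData R) k (Dom.recentre X) n := by
  by_cases hjk : R.carriers.scale X = k
  · obtain ⟨j, Y⟩ := X
    change j = k at hjk
    subst hjk
    rw [recentre_eq_translateAt, termLabels_translateAt hX]
    rfl
  · have h1 : termLabels (domainGeometry R) (b13InnerData R) k X n = ∅ :=
      Finset.eq_empty_of_forall_notMem fun p hp =>
        hjk (scale_eq_of_localizesAt ((mem_termLabels (domainGeometry R) (b13InnerData R)).1 hp))
    have h2 : termLabels (domainGeometry R) (b13InnerData R) k (Dom.recentre X) n = ∅ :=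
      Finset.eq_empty_of_forall_notMem fun p hp => by
        have hs := scale_eq_of_localizesAt ((mem_termLabels (domainGeometry R) (b13InnerData R)).1 hp)
        rw [B13CarriersTranslation.Dom.scale_recentre] at hs
        exact hjk hs
    rw [h1, h2, Finset.map_empty]

/-- [folklore] **EVERY CODE IS PINNED AT THE ORIGIN**: the code of a label localizing at `X` (scale in range) localizes at a domain
of the same scale containing the origin cube of its torus (leaf-05's `zero_mem_recentre`). -/
theorem code_pinned {X : R.carriers.Dom} (hX : X.1 + R.m' ≤ R.F.m + R.K) {k : ℕ} {t : TermIdx R.carriers.Dom (Bnd R)}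
    (ht : t.LocalizesAt (domainGeometry R) (b13InnerData R) k X) :
    ((anchored R).code k X t).LocalizesAt (domainGeometry R) (b13InnerData R) k (Dom.recentre X) ∧
      (0 : TPt 4 (R.cubesPerDir X.1)) ∈ (Dom.recentre X).2.1 :=
  ⟨(localizesAt_code_iff hX k t).2 ht, Dom.zero_mem_recentre X⟩

/-- [folklore] **THE CODES IN USE AT AN OUTPUT LEVEL ARE ORIGIN-PINNED LABELS** (design v0.3 R9's consequence «`G` = ONE
(1.26)-type shape sum, volume-uniform» in kernel form): at an output scale `k` in the meaningful range, the union over ALL output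
domains `X ∈ 𝐃_k` of the catalogues of codes is contained in the union of the catalogues of the domains `S ∈ 𝐃_k` containing the
origin cube — a termwise weight read on codes is summed over labels pinned at the origin, not over the volume. -/
theorem codes_subset_pinned {k : ℕ} (hk : k + R.m' ≤ R.F.m + R.K) (n : ℕ) :
    (R.domAt k).biUnion (fun X => (termLabels (domainGeometry R) (b13InnerData R) k X n).map (codeTuple X n)) ⊆
      ((R.domAt k).filter fun S => (0 : TPt 4 (R.cubesPerDir S.1)) ∈ S.2.1).biUnion
        fun S => termLabels (domainGeometry R) (b13InnerData R) k S n := by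
  intro p hp
  obtain ⟨X, hX, hpX⟩ := Finset.mem_biUnion.1 hp
  have hXk : X.1 = k := R.mem_domAt.1 hX
  have hXr : X.1 + R.m' ≤ R.F.m + R.K := by rw [hXk]; exact hk
  rw [termLabels_map_anchored hXr] at hpX
  refine Finset.mem_biUnion.2 ⟨Dom.recentre X, Finset.mem_filter.2 ⟨?_, Dom.zero_mem_recentre X⟩, hpX⟩
  rw [TwoRuns.mem_domAt]; exact hXk

/-- [folklore] **A CODED SUM AT `X` IS THE SAME SUM OVER THE RECENTRED CATALOGUE**: for any weight `f` on tuples of factor labels,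
`Σ_{p ∈ termLabels k X n} f (code p) = Σ_{q ∈ termLabels k (recentre X) n} f q` (scale of `X` in range). -/
theorem sum_code_eq {M : Type*} [AddCommMonoid M] {X : R.carriers.Dom} (hX : X.1 + R.m' ≤ R.F.m + R.K) (k n : ℕ)
    (f : (Fin (n + 1) → PolyLabel R.carriers.Dom (Bnd R)) → M) :
    ∑ p ∈ termLabels (domainGeometry R) (b13InnerData R) k X n, f (codeTuple X n p) =
      ∑ q ∈ termLabels (domainGeometry R) (b13InnerData R) k (Dom.recentre X) n, f q := by
  rw [← termLabels_map_anchored hX, Finset.sum_map]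

/-- [folklore] **THE VOLUME-UNIFORM BUDGET OF R9 IN KERNEL FORM**: a NONNEGATIVE `X`-blind weight `f`, read on the codes of the labels
localizing at ANY output domain `X ∈ 𝐃_k` (scale in range), sums to at most ONE origin-pinned shape sum
`Σ_{S ∈ 𝐃_k, 0 ∈ S} Σ_{q ∈ termLabels k S n} f q` — a bound that does not see `X`, nor the number of domains in the step volume
(design finding l.5621: absolute labels would make the same budget extensive, `∝ L^{4(K−k)}`). -/
theorem sum_code_le_pinned {k : ℕ} (hk : k + R.m' ≤ R.F.m + R.K) (n : ℕ)
    (f : (Fin (n + 1) → PolyLabel R.carriers.Dom (Bnd R)) → ℝ) (hf : ∀ q, 0 ≤ f q) {X : R.carriers.Dom} (hX : X ∈ R.domAt k) :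
    ∑ p ∈ termLabels (domainGeometry R) (b13InnerData R) k X n, f (codeTuple X n p) ≤
      ∑ S ∈ (R.domAt k).filter (fun S => (0 : TPt 4 (R.cubesPerDir S.1)) ∈ S.2.1),
        ∑ q ∈ termLabels (domainGeometry R) (b13InnerData R) k S n, f q := by
  have hXk : X.1 = k := R.mem_domAt.1 hX
  have hXr : X.1 + R.m' ≤ R.F.m + R.K := by rw [hXk]; exact hk
  rw [sum_code_eq hXr]
  refine Finset.single_le_sum (f := fun S => ∑ q ∈ termLabels (domainGeometry R) (b13InnerData R) k S n, f q)
    (fun S _ => Finset.sum_nonneg fun q _ => hf q) (Finset.mem_filter.2 ⟨?_, Dom.zero_mem_recentre X⟩)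
  rw [TwoRuns.mem_domAt]; exact hXk

/-- [folklore] **`TermRep` RE-CODES LOSSLESSLY ALONG THE ANCHORED CODING** (`B13StepTermLabels.Coding.termRep_lift` at the instance of
record, BY NAME): a term family over absolute labels representing a step model's output on a class, and vanishing off the localizing
labels, yields the anchored-coded family representing the same output. -/
theorem termRep_anchored {Op Hist : Type*} [NormedAddCommGroup Op] [NormedSpace ℂ Op] [NormedAddCommGroup Hist]
    [NormedSpace ℂ Hist] (M : StepModel R.carriers Op Hist) (K : ℕ → (ℕ → ℝ) → R.carriers.BgB → Set (Op × Hist))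
    (T : ℕ → TermIdx R.carriers.Dom (Bnd R) → Op → Hist → R.carriers.Dom → ℂ) {W : Set (ℕ → ℝ)}
    (hsupp : ∀ k (X : R.carriers.Dom) (o : Op) (h : Hist) (t : TermIdx R.carriers.Dom (Bnd R)),
      ¬ t.LocalizesAt (domainGeometry R) (b13InnerData R) k X → T k t o h X = 0)
    (hrep : TermRep M K T W) : TermRep M K ((anchored R).lift T) W :=
  (anchored R).termRep_lift M K T hsupp hrep

/-- [folklore] THE CODE KEEPS `ρᵀ`, THE COEFFICIENT AND THE TREE LENGTHS (so every termwise weight built from them is `X`-blind on codes). -/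
theorem coeff_code (k : ℕ) (X : R.carriers.Dom) (t : TermIdx R.carriers.Dom (Bnd R)) :
    coeff (domainGeometry R) ((anchored R).code k X t) = coeff (domainGeometry R) t ∧
      ∀ i : Fin (t.1 + 1), R.carriers.d (((anchored R).code k X t).polys i) = R.carriers.d (t.polys i) :=
  ⟨coeff_translate X.1 _ t, fun i => d_polys_translate X.1 _ t i⟩

end Anchored

end Summit.QuantumFields.BalabanUV.T4Continuum.B13StepTermCoding

end
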